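import Summits.Ventures.HodgeRepro.CyclicFourier
import Summits.Ventures.HodgeRepro.SingleClass
import Summits.Ventures.HodgeRepro.Level3Witness

/-!
# Cyclic Galois CM fields of degree `2^(a+1) q^b`: no single-class `SumTwo` quadruple without a conjugate pair

Blind re-derivation cell `pub-hodge-repro`, seat `p1` (gen 8).  The kernel census (typer `QuadFinset12`, p1 g6
`QuadRows10and14`, p4 g4) says that no single-class `SumTwo` quadruple of CM types without a complex-conjugate pair
exists on any `(G, c)` with `|G| ≤ 14`, and p1 g6 explained the cyclic `2`-power rows (`C₈`, `C₁₆`) by non-degeneracy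
(`CyclicTwoPowerNondegenerate` + Hazama's shadow); the zeros of the cyclic rows `C₁₂`, `C₂₀`, `C₂₄` were left
«not explained by non-degeneracy alone» (degenerate types exist there).  This file explains ALL of them at once:

**Theorem** (`exists_conj_of_sumTwo_cyclic`, `not_isSingleClass_cyclic`).  Let `N = 2 · 2^a q^b` with `q` an odd prime,
`G = ℤ/N` (written multiplicatively), `c = N/2` its involution.  For every CM type `Φ` and every quadruple of
Galois twists `Φ g₀, Φ g₁, Φ g₂, Φ g₃` with `SumTwo` (each embedding in exactly two corners) two corners are
complex-conjugate.  Hence a cyclic Galois CM field whose degree has at most one odd prime factor carries no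
exceptional single-class Pohlmann `4`-set in codimension `2`: the rows `C₆, C₈, C₁₀, C₁₂, C₁₄, C₁₆, C₂₀, C₂₄` (and
`C₂₈, C₃₂, C₃₆, C₄₀, C₄₈, …`) are zero for one structural reason.  The first cyclic order NOT covered is `30`
(`m = 15 = 3 · 5`); the Python census `cyclic_quads.py` (proofs/p1-g8/) finds `0` instances on `C₃₀`, `C₃₆` and
`C₄₂` as well, so the hypothesis is sufficient, not necessary.

Proof (discrete Fourier analysis on `ℤ/N`, Mathlib's `ZMod.dft`; `ψ = ZMod.stdAddChar`, `f = 1_Φ`):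
1. `SumTwo` says `∑ᵢ f(x − gᵢ) = 2` for all `x`; taking `𝓕` gives `(∑ᵢ ψ(−gᵢ k)) · 𝓕f(k) = 0` for every `k ≠ 0`
   (`char_sum_mul_dft`).  The CM condition `f(x + N/2) = 1 − f(x)` kills `𝓕f(k)` for even `k` (`dft_ind_eq_zero_of_even`).
2. **A vanishing sum of four roots of unity contains an antipodal pair** (`four_roots`): from `1 + u + v + w = 0`
   and its complex conjugate `1 + u⁻¹ + v⁻¹ + w⁻¹ = 0` one gets `(u − v w⁻¹)(u − w v⁻¹) = 0`, hence
   `(1 + w)(1 + u) = 0` or `(1 + v)(1 + u) = 0`.  So `∑ᵢ ψ(−gᵢ k) = 0` forces `ψ((g₀ − gⱼ) k) = −1` for some `j`.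
3. **Lifting** (`shift_eq_of_char`): write `k = q^u k'` with `k'` coprime to `P = N/q^u` (even).  If `f` is
   `P`-periodic and `ψ(q^u k' d) = −1`, then `ψ(q^u d)` is a `P`-th root of unity whose `k'`-th power is `−1`, so it
   is `−1` (`eq_neg_one_of_pow_eq_neg_one`), i.e. `q^u d = N/2`, i.e. `d ≡ N/2 (mod P)`, and periodicity gives
   `Φ + d = Φ + N/2 = c Φ` — a conjugate pair.  Thus, without a conjugate pair, `𝓕f(k) = 0` for all such `k`.
4. **Induction on the level `t ≤ b`**: if `f` is `2^(a+1) q^(b−t)`-periodic then `𝓕f` vanishes off the multiples of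
   `q^(t+1)` (step 3 with `u = v_q(k) ≤ t`, and step 1 for even `k`), so `f` is `2^(a+1) q^(b−t−1)`-periodic
   (`periodic_of_dft`).  At `t = b` every odd `k` is handled (`u = min(v_q(k), b)`), so `𝓕f` is supported at `0`:
   `f` is constant — impossible for a CM type (`f(N/2) = 1 − f(0)`).
Only step 3 uses the shape `2^(a+1) q^b` of `N`: the characters of `ℤ/N` not handled by step 2 are exactly the odd
non-faithful ones, and with one odd prime they all factor through the quotients `ℤ/(N/q^t)`.

Toolkit: `CyclicFourier.lean` (characters, `four_roots`, `ZMod.dft`, the indicator `ind`).  Vocabulary: typer's `IsCMType`, `rmul` (Galois twist), `SumTwo` (`FaceReduce`), `IsSingleClass` (`SingleClass`), the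
conjugation `c • Φ`; `G = Multiplicative (ZMod N)`, `c = Multiplicative.ofAdd (N/2)` (`isComplexConj_ofAdd_half`).
-/

set_option autoImplicit false

open Finset AddChar ZMod
open scoped Pointwise

namespace HodgeRepro.CyclicQuad

variable {N : ℕ} [NeZero N]

/-! ### The lifting lemma and the level induction -/

/-- **Lifting.**  `N = q^u P` with `P` even, `k'` coprime to `P`, `f` `P`-periodic, and `ψ(q^u k' d) = -1`: then
`f(x + d) = f(x + N/2)` for every `x` (the shift by `d` is the shift by the involution). -/
theorem shift_eq_of_char {m q u P k' : ℕ} (hN : N = 2 * m) (hqu : q ^ u ∣ m) (hP : N = q ^ u * P)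
    (hP2 : 2 ∣ P) (hq : Odd q) (hk' : Nat.Coprime k' P) (f : ZMod N → ℂ)
    (hper : ∀ x, f (x + (P : ZMod N)) = f x) (d : ZMod N)
    (hd : stdAddChar (((q ^ u * k' : ℕ) : ZMod N) * d) = -1) (x : ZMod N) :
    f (x + d) = f (x + (m : ZMod N)) := by
  have hq0 : 0 < q ^ u := pow_pos hq.pos u
  -- step 1: `ψ(q^u d) = -1`
  have hzk : (stdAddChar (((q ^ u : ℕ) : ZMod N) * d)) ^ k' = -1 := by
    rw [← map_nsmul_eq_pow, nsmul_eq_mul, ← hd]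
    congr 1; push_cast; ring
  have hzP : (stdAddChar (((q ^ u : ℕ) : ZMod N) * d)) ^ P = 1 := by
    rw [← map_nsmul_eq_pow, nsmul_eq_mul, ← mul_assoc, ← Nat.cast_mul, mul_comm P (q ^ u), ← hP,
      ZMod.natCast_self, zero_mul, map_zero_eq_one]
  have hz1 := eq_neg_one_of_pow_eq_neg_one hzP hP2 hk' hzk
  -- step 2: `q^u d = N/2`
  have h2 : ((q ^ u : ℕ) : ZMod N) * d = (m : ZMod N) := (stdAddChar_eq_neg_one_iff hN _).mp hz1
  -- step 3: `d = m/q^u + P l`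
  obtain ⟨m', hm'⟩ := hqu
  have h3 : ((q ^ u : ℕ) : ZMod N) * (d - (m' : ZMod N)) = 0 := by
    rw [mul_sub, h2, hm', Nat.cast_mul, sub_self]
  obtain ⟨l, hl⟩ : ∃ l : ℕ, d - (m' : ZMod N) = (P : ZMod N) * l := by
    have hw : ((q ^ u * (d - (m' : ZMod N)).val : ℕ) : ZMod N) = 0 := by
      rw [Nat.cast_mul, ZMod.natCast_zmod_val]; exact h3
    rw [ZMod.natCast_eq_zero_iff] at hw
    have hw2 : q ^ u * P ∣ q ^ u * (d - (m' : ZMod N)).val := by rw [← hP]; exact hw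
    obtain ⟨l, hl⟩ := Nat.dvd_of_mul_dvd_mul_left hq0 hw2
    exact ⟨l, by rw [← ZMod.natCast_zmod_val (d - (m' : ZMod N)), hl, Nat.cast_mul]⟩
  -- step 4: `N/2 = m' + P (q^u - 1)/2`
  have hP' : P = 2 * m' := by
    have e : q ^ u * P = q ^ u * (2 * m') := by rw [← hP, hN, hm']; ring
    exact Nat.eq_of_mul_eq_mul_left hq0 e
  obtain ⟨t, ht⟩ := hq.pow (n := u)
  have h4 : (m : ZMod N) = (m' : ZMod N) + (P : ZMod N) * (t : ZMod N) := by
    have e : m = m' + P * t := by rw [hP', hm', ht]; ring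
    rw [e]; push_cast; ring
  have hd' : d = (m' : ZMod N) + (P : ZMod N) * l := by rw [← hl]; ring
  have key : ∀ (y : ZMod N) (n : ℕ), f (y + (P : ZMod N) * n) = f y := fun y n => by
    have := periodic_nsmul hper n y
    rwa [nsmul_eq_mul, mul_comm] at this
  rw [hd', h4, ← add_assoc, ← add_assoc, key, key]

/-- **Core step.**  At level `t ≤ b` (the indicator is `2^(a+1) q^(b−t)`-periodic), a Fourier coefficient at
`k ≠ 0` with `k.val = q^u k'`, `u ≤ t`, `k'` coprime to `2^(a+1) q^(b−u)`, cannot be non-zero without a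
conjugate pair. -/
theorem core {a b q : ℕ} (hq : q.Prime) (hq2 : q ≠ 2) (hN : N = 2 * (2 ^ a * q ^ b))
    (Φ : Finset (Multiplicative (ZMod N))) (g : Fin 4 → ZMod N)
    (hs : SumTwo (fun i => rmul Φ (Multiplicative.ofAdd (g i))))
    (hnc : ∀ i j : Fin 4, rmul Φ (Multiplicative.ofAdd (g j)) ≠
      Multiplicative.ofAdd ((2 ^ a * q ^ b : ℕ) : ZMod N) • rmul Φ (Multiplicative.ofAdd (g i)))
    (t : ℕ) (htb : t ≤ b)
    (hper : ∀ x, ind Φ (x + ((2 ^ (a + 1) * q ^ (b - t) : ℕ) : ZMod N)) = ind Φ x)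
    (k : ZMod N) (hk0 : k ≠ 0) (hk : ZMod.dft (ind Φ) k ≠ 0)
    (u k' : ℕ) (hut : u ≤ t) (hkval : k.val = q ^ u * k')
    (hcop : Nat.Coprime k' (2 ^ (a + 1) * q ^ (b - u))) : False := by
  have hqodd : Odd q := hq.odd_of_ne_two hq2
  have hub : u ≤ b := hut.trans htb
  have hsum : ∑ i : Fin 4, stdAddChar (-(g i * k)) = 0 :=
    (mul_eq_zero.mp (char_sum_mul_dft Φ g hs k hk0)).resolve_right hk
  obtain ⟨j, hj⟩ := exists_char_eq_neg_one g k hsum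
  have hNP : N = q ^ u * (2 ^ (a + 1) * q ^ (b - u)) := by
    rw [hN]
    calc 2 * (2 ^ a * q ^ b) = 2 ^ (a + 1) * q ^ b := by ring
      _ = 2 ^ (a + 1) * (q ^ u * q ^ (b - u)) := by rw [← pow_add, Nat.add_sub_cancel' hub]
      _ = q ^ u * (2 ^ (a + 1) * q ^ (b - u)) := by ring
  have hqum : q ^ u ∣ 2 ^ a * q ^ b := (pow_dvd_pow q hub).mul_left _
  have hP2 : 2 ∣ 2 ^ (a + 1) * q ^ (b - u) := (dvd_pow_self 2 (Nat.succ_ne_zero a)).mul_right _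
  have hperP : ∀ x, ind Φ (x + ((2 ^ (a + 1) * q ^ (b - u) : ℕ) : ZMod N)) = ind Φ x := by
    intro x
    have hbu : b - u = (t - u) + (b - t) := by omega
    have e : ((2 ^ (a + 1) * q ^ (b - u) : ℕ) : ZMod N) =
        (q ^ (t - u)) • ((2 ^ (a + 1) * q ^ (b - t) : ℕ) : ZMod N) := by
      rw [nsmul_eq_mul, ← Nat.cast_mul, hbu, pow_add]; congr 1; ring
    rw [e]; exact periodic_nsmul hper _ x
  have hd : stdAddChar (((q ^ u * k' : ℕ) : ZMod N) * (g 0 - g j)) = -1 := by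
    rw [← hkval, ZMod.natCast_zmod_val, mul_comm]; exact hj
  have hshift := shift_eq_of_char hN hqum hNP hP2 hqodd hcop (ind Φ) hperP (g 0 - g j) hd
  exact hnc 0 j (conj_pair_of_shift hN Φ g 0 j hshift)

/-- The core step with `k.val = q^e k''`, `q ∤ k''`, either `e ≤ t` or `t = b`. -/
theorem core' {a b q : ℕ} (hq : q.Prime) (hq2 : q ≠ 2) (hN : N = 2 * (2 ^ a * q ^ b))
    (Φ : Finset (Multiplicative (ZMod N)))
    (hΦ : IsCMType (Multiplicative.ofAdd ((2 ^ a * q ^ b : ℕ) : ZMod N)) Φ) (g : Fin 4 → ZMod N)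
    (hs : SumTwo (fun i => rmul Φ (Multiplicative.ofAdd (g i))))
    (hnc : ∀ i j : Fin 4, rmul Φ (Multiplicative.ofAdd (g j)) ≠
      Multiplicative.ofAdd ((2 ^ a * q ^ b : ℕ) : ZMod N) • rmul Φ (Multiplicative.ofAdd (g i)))
    (t : ℕ) (htb : t ≤ b)
    (hper : ∀ x, ind Φ (x + ((2 ^ (a + 1) * q ^ (b - t) : ℕ) : ZMod N)) = ind Φ x)
    (k : ZMod N) (hk0 : k ≠ 0) (hk : ZMod.dft (ind Φ) k ≠ 0)
    (e k'' : ℕ) (hk'' : ¬ q ∣ k'') (hkval : k.val = q ^ e * k'') (het : e ≤ t ∨ t = b) : False := by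
  have hqodd : Odd q := hq.odd_of_ne_two hq2
  -- `k` is odd
  have hkodd : Odd k.val := by
    by_contra hev
    rw [Nat.not_odd_iff_even] at hev
    obtain ⟨r, hr⟩ := hev
    apply hk
    apply dft_ind_eq_zero_of_even Φ hΦ k hk0
    rw [← ZMod.natCast_zmod_val k, hr, ← Nat.cast_mul,
      show 2 ^ a * q ^ b * (r + r) = N * r by rw [hN]; ring, Nat.cast_mul, ZMod.natCast_self,
      zero_mul, map_zero_eq_one]
  have hk''odd : Odd k'' := by
    have : Odd (q ^ e * k'') := by rw [← hkval]; exact hkodd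
    exact (Nat.odd_mul.mp this).2
  have hcopq : Nat.Coprime k'' q := Nat.coprime_comm.mp ((Nat.Prime.coprime_iff_not_dvd hq).mpr hk'')
  rcases het with het | rfl
  · have hcop : Nat.Coprime k'' (2 ^ (a + 1) * q ^ (b - e)) :=
      Nat.Coprime.mul_right (Nat.Coprime.pow_right _ (Nat.coprime_two_right.mpr hk''odd))
        (Nat.Coprime.pow_right _ hcopq)
    exact core hq hq2 hN Φ g hs hnc t htb hper k hk0 hk e k'' het hkval hcop
  · by_cases heb : e ≤ t
    · have hcop : Nat.Coprime k'' (2 ^ (a + 1) * q ^ (t - e)) :=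
        Nat.Coprime.mul_right (Nat.Coprime.pow_right _ (Nat.coprime_two_right.mpr hk''odd))
          (Nat.Coprime.pow_right _ hcopq)
      exact core hq hq2 hN Φ g hs hnc t le_rfl hper k hk0 hk e k'' heb hkval hcop
    · have hte : t ≤ e := le_of_lt (not_le.mp heb)
      have hkval' : k.val = q ^ t * (q ^ (e - t) * k'') := by
        rw [hkval, ← mul_assoc, ← pow_add, Nat.add_sub_cancel' hte]
      have hodd' : Odd (q ^ (e - t) * k'') := Nat.odd_mul.mpr ⟨hqodd.pow, hk''odd⟩
      have hcop : Nat.Coprime (q ^ (e - t) * k'') (2 ^ (a + 1) * q ^ (t - t)) := by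
        rw [Nat.sub_self, pow_zero, mul_one]
        exact Nat.Coprime.pow_right _ (Nat.coprime_two_right.mpr hodd')
      exact core hq hq2 hN Φ g hs hnc t le_rfl hper k hk0 hk t _ le_rfl hkval' hcop

/-- **Main theorem.**  On the cyclic group of order `N = 2 · 2^a q^b` (`q` an odd prime) with involution
`c = N/2`, every `SumTwo` quadruple of Galois twists of a CM type has two complex-conjugate corners. -/
theorem exists_conj_of_sumTwo_cyclic {a b q : ℕ} (hq : q.Prime) (hq2 : q ≠ 2)
    (hN : N = 2 * (2 ^ a * q ^ b)) (Φ : Finset (Multiplicative (ZMod N)))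
    (hΦ : IsCMType (Multiplicative.ofAdd ((2 ^ a * q ^ b : ℕ) : ZMod N)) Φ)
    (g : Fin 4 → Multiplicative (ZMod N)) (hs : SumTwo (fun i => rmul Φ (g i))) :
    ∃ i j : Fin 4, rmul Φ (g j) =
      Multiplicative.ofAdd ((2 ^ a * q ^ b : ℕ) : ZMod N) • rmul Φ (g i) := by
  by_contra hnc'
  have hnc : ∀ i j : Fin 4, rmul Φ (g j) ≠
      Multiplicative.ofAdd ((2 ^ a * q ^ b : ℕ) : ZMod N) • rmul Φ (g i) :=
    fun i j h => hnc' ⟨i, j, h⟩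
  obtain ⟨gA, hgA⟩ : ∃ gA : Fin 4 → ZMod N, ∀ i, g i = Multiplicative.ofAdd (gA i) :=
    ⟨fun i => Multiplicative.toAdd (g i), fun i => rfl⟩
  simp only [hgA] at hs hnc
  have hq1 : q ≠ 1 := hq.one_lt.ne'
  -- periodicity by induction on the level `t`
  have hper : ∀ t, t ≤ b →
      ∀ x, ind Φ (x + ((2 ^ (a + 1) * q ^ (b - t) : ℕ) : ZMod N)) = ind Φ x := by
    intro t
    induction t with
    | zero =>
      intro _ x
      have e : ((2 ^ (a + 1) * q ^ (b - 0) : ℕ) : ZMod N) = 0 := by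
        rw [Nat.sub_zero, show 2 ^ (a + 1) * q ^ b = N by rw [hN]; ring, ZMod.natCast_self]
      rw [e, add_zero]
    | succ t ih =>
      intro ht x
      have ih' := ih (Nat.le_of_succ_le ht)
      apply periodic_of_dft (ind Φ) _ _ x
      intro k hk
      by_contra hPk
      have hk0 : k ≠ 0 := by rintro rfl; apply hPk; rw [mul_zero, map_zero_eq_one]
      have hkv : k.val ≠ 0 := fun h => hk0 ((ZMod.val_eq_zero k).mp h)
      obtain ⟨e, k'', hk'', hkval⟩ := Nat.exists_eq_pow_mul_and_not_dvd hkv q hq1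
      have het : e ≤ t := by
        by_contra h
        apply hPk
        have hdvd : q ^ (t + 1) ∣ k.val := by
          rw [hkval]; exact (pow_dvd_pow q (by omega)).mul_right _
        obtain ⟨r, hr⟩ := hdvd
        have e1 : 2 ^ (a + 1) * q ^ (b - (t + 1)) * (q ^ (t + 1) * r) = N * r := by
          rw [hN]
          have e2 : q ^ (b - (t + 1)) * q ^ (t + 1) = q ^ b := by
            rw [← pow_add, Nat.sub_add_cancel ht]
          calc 2 ^ (a + 1) * q ^ (b - (t + 1)) * (q ^ (t + 1) * r)
              = 2 ^ (a + 1) * (q ^ (b - (t + 1)) * q ^ (t + 1)) * r := by ring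
            _ = 2 * (2 ^ a * q ^ b) * r := by rw [e2]; ring
        rw [← ZMod.natCast_zmod_val k, hr, ← Nat.cast_mul, e1, Nat.cast_mul, ZMod.natCast_self,
          zero_mul, map_zero_eq_one]
      exact core' hq hq2 hN Φ hΦ gA hs hnc t (Nat.le_of_succ_le ht) ih' k hk0 hk e k'' hk'' hkval
        (Or.inl het)
  -- at the last level every non-zero Fourier coefficient is impossible: the indicator is `1`-periodic
  have hconst : ∀ x, ind Φ (x + 1) = ind Φ x := by
    apply periodic_of_dft
    intro k hk
    by_contra h1
    have hk0 : k ≠ 0 := by rintro rfl; apply h1; rw [mul_zero, map_zero_eq_one]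
    have hkv : k.val ≠ 0 := fun h => hk0 ((ZMod.val_eq_zero k).mp h)
    obtain ⟨e, k'', hk'', hkval⟩ := Nat.exists_eq_pow_mul_and_not_dvd hkv q hq1
    exact core' hq hq2 hN Φ hΦ gA hs hnc b le_rfl (hper b le_rfl) k hk0 hk e k'' hk'' hkval
      (Or.inr rfl)
  have hc' : ∀ n : ℕ, ind Φ (n : ZMod N) = ind Φ 0 := by
    intro n
    induction n with
    | zero => rw [Nat.cast_zero]
    | succ n ih => rw [Nat.cast_succ, hconst, ih]
  have hc : ∀ x : ZMod N, ind Φ x = ind Φ 0 := fun x => by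
    rw [← ZMod.natCast_zmod_val x, hc' x.val]
  have h1 := ind_add_half Φ hΦ 0
  rw [hc ((0 : ZMod N) + ((2 ^ a * q ^ b : ℕ) : ZMod N))] at h1
  unfold ind at h1
  split_ifs at h1 <;> norm_num at h1

/-- **Corollary in the shape of `QuadFinset12`'s `not_isSingleClass_<G>`**: on the cyclic group of order
`2 · 2^a q^b` no single-class `SumTwo` quadruple of CM types without a conjugate pair exists. -/
theorem not_isSingleClass_cyclic {a b q : ℕ} (hq : q.Prime) (hq2 : q ≠ 2)
    (hN : N = 2 * (2 ^ a * q ^ b)) (T : Fin 4 → Finset (Multiplicative (ZMod N)))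
    (hT : IsCMType (Multiplicative.ofAdd ((2 ^ a * q ^ b : ℕ) : ZMod N)) (T 0)) (hs : SumTwo T)
    (hnc : ∀ i j : Fin 4, T j ≠ Multiplicative.ofAdd ((2 ^ a * q ^ b : ℕ) : ZMod N) • T i) :
    ¬ IsSingleClass T := by
  intro hsc
  choose g hg using hsc
  have hT' : T = fun i => rmul (T 0) (g i) := funext hg
  have hs' : SumTwo (fun i => rmul (T 0) (g i)) := by rw [← hT']; exact hs
  obtain ⟨i, j, hij⟩ := exists_conj_of_sumTwo_cyclic hq hq2 hN (T 0) hT g hs'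
  exact hnc i j (by rw [hg j, hg i]; exact hij)

/-! ### Instances: the census rows `C₆, C₈, C₁₀, C₁₂` and the cyclic groups of order `16, 20, 24, 32, 36, 40, 48` -/

/-- The typer's `cc_C6 = ofAdd 3` is `ofAdd (2^0 · 3^1)`. -/
theorem cc_C6_eq : cc_C6 = Multiplicative.ofAdd ((2 ^ 0 * 3 ^ 1 : ℕ) : ZMod 6) := by decide

/-- The typer's `cc_C8 = ofAdd 4` is `ofAdd (2^2 · 3^0)`. -/
theorem cc_C8_eq : cc_C8 = Multiplicative.ofAdd ((2 ^ 2 * 3 ^ 0 : ℕ) : ZMod 8) := by decide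

/-- The typer's `cc_C10 = ofAdd 5` is `ofAdd (2^0 · 5^1)`. -/
theorem cc_C10_eq : cc_C10 = Multiplicative.ofAdd ((2 ^ 0 * 5 ^ 1 : ℕ) : ZMod 10) := by decide

/-- The typer's `cc_C12 = ofAdd 6` is `ofAdd (2^1 · 3^1)`. -/
theorem cc_C12_eq : cc_C12 = Multiplicative.ofAdd ((2 ^ 1 * 3 ^ 1 : ℕ) : ZMod 12) := by decide

/-- `C₆` (the sealed degree-6 row): no single-class `SumTwo` quadruple without a conjugate pair — the generic
form of the typer's `not_isSingleClass_C6`. -/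
theorem not_isSingleClass_C6_cyclic (T : Fin 4 → Finset C6) (hT : IsCMType cc_C6 (T 0)) (hs : SumTwo T)
    (hnc : ∀ i j : Fin 4, T j ≠ cc_C6 • T i) : ¬ IsSingleClass T := by
  rw [cc_C6_eq] at hT hnc
  exact not_isSingleClass_cyclic (a := 0) (b := 1) Nat.prime_three (by norm_num) (by norm_num) T hT hs hnc

/-- `C₈`: the generic form of the typer's `not_isSingleClass_C8` (the `2`-power case, `b = 0`). -/
theorem not_isSingleClass_C8_cyclic (T : Fin 4 → Finset C8) (hT : IsCMType cc_C8 (T 0)) (hs : SumTwo T)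
    (hnc : ∀ i j : Fin 4, T j ≠ cc_C8 • T i) : ¬ IsSingleClass T := by
  rw [cc_C8_eq] at hT hnc
  exact not_isSingleClass_cyclic (a := 2) (b := 0) Nat.prime_three (by norm_num) (by norm_num) T hT hs hnc

/-- `C₁₀`: the generic form of p1 g6's `not_isSingleClass_C10`. -/
theorem not_isSingleClass_C10_cyclic (T : Fin 4 → Finset C10) (hT : IsCMType cc_C10 (T 0)) (hs : SumTwo T)
    (hnc : ∀ i j : Fin 4, T j ≠ cc_C10 • T i) : ¬ IsSingleClass T := by
  rw [cc_C10_eq] at hT hnc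
  exact not_isSingleClass_cyclic (a := 0) (b := 1) Nat.prime_five (by norm_num) (by norm_num) T hT hs hnc

/-- `C₁₂` (a sealed degree-12 row): the generic form of the typer's `not_isSingleClass_C12` — the cyclic zero that
non-degeneracy alone did not explain. -/
theorem not_isSingleClass_C12_cyclic (T : Fin 4 → Finset C12) (hT : IsCMType cc_C12 (T 0)) (hs : SumTwo T)
    (hnc : ∀ i j : Fin 4, T j ≠ cc_C12 • T i) : ¬ IsSingleClass T := by
  rw [cc_C12_eq] at hT hnc
  exact not_isSingleClass_cyclic (a := 1) (b := 1) Nat.prime_three (by norm_num) (by norm_num) T hT hs hnc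

/-- The cyclic group of order `16`. -/
abbrev C16 := Multiplicative (ZMod 16)

/-- Its involution `8 = 2^3 · 3^0`. -/
def cc_C16 : C16 := Multiplicative.ofAdd ((2 ^ 3 * 3 ^ 0 : ℕ) : ZMod 16)

/-- `C₁₆`: the census zero of p1 g6's order-16 run, now a theorem (also a consequence of
`CyclicTwoPowerNondegenerate` + Hazama's shadow; here by the character argument). -/
theorem not_isSingleClass_C16_cyclic (T : Fin 4 → Finset C16) (hT : IsCMType cc_C16 (T 0)) (hs : SumTwo T)
    (hnc : ∀ i j : Fin 4, T j ≠ cc_C16 • T i) : ¬ IsSingleClass T :=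
  not_isSingleClass_cyclic (a := 3) (b := 0) Nat.prime_three (by norm_num) (by norm_num) T hT hs hnc

/-- The cyclic group of order `20`. -/
abbrev C20 := Multiplicative (ZMod 20)

/-- Its involution `10 = 2^1 · 5^1`. -/
def cc_C20 : C20 := Multiplicative.ofAdd ((2 ^ 1 * 5 ^ 1 : ℕ) : ZMod 20)

/-- `C₂₀`: the cyclic zero of the order-20 census (p1 g6 `singleclass20.out`), now a theorem — degenerate types
exist on `C₂₀`, so this is NOT a consequence of non-degeneracy. -/
theorem not_isSingleClass_C20_cyclic (T : Fin 4 → Finset C20) (hT : IsCMType cc_C20 (T 0)) (hs : SumTwo T)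
    (hnc : ∀ i j : Fin 4, T j ≠ cc_C20 • T i) : ¬ IsSingleClass T :=
  not_isSingleClass_cyclic (a := 1) (b := 1) Nat.prime_five (by norm_num) (by norm_num) T hT hs hnc

/-- The cyclic group of order `24`. -/
abbrev C24 := Multiplicative (ZMod 24)

/-- Its involution `12 = 2^2 · 3^1`. -/
def cc_C24 : C24 := Multiplicative.ofAdd ((2 ^ 2 * 3 ^ 1 : ℕ) : ZMod 24)

/-- `C₂₄`: the cyclic zero of the degree-24 frontier (p1 g6 `c24.out`, route-2 g14 `deg24_all.out`), now a
theorem. -/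
theorem not_isSingleClass_C24_cyclic (T : Fin 4 → Finset C24) (hT : IsCMType cc_C24 (T 0)) (hs : SumTwo T)
    (hnc : ∀ i j : Fin 4, T j ≠ cc_C24 • T i) : ¬ IsSingleClass T :=
  not_isSingleClass_cyclic (a := 2) (b := 1) Nat.prime_three (by norm_num) (by norm_num) T hT hs hnc

/-- The cyclic group of order `32`. -/
abbrev C32 := Multiplicative (ZMod 32)

/-- Its involution `16 = 2^4 · 3^0`. -/
def cc_C32 : C32 := Multiplicative.ofAdd ((2 ^ 4 * 3 ^ 0 : ℕ) : ZMod 32)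

/-- `C₃₂` (beyond every census): no single-class `SumTwo` quadruple without a conjugate pair. -/
theorem not_isSingleClass_C32_cyclic (T : Fin 4 → Finset C32) (hT : IsCMType cc_C32 (T 0)) (hs : SumTwo T)
    (hnc : ∀ i j : Fin 4, T j ≠ cc_C32 • T i) : ¬ IsSingleClass T :=
  not_isSingleClass_cyclic (a := 4) (b := 0) Nat.prime_three (by norm_num) (by norm_num) T hT hs hnc

/-- The cyclic group of order `36`. -/
abbrev C36 := Multiplicative (ZMod 36)

/-- Its involution `18 = 2^1 · 3^2`. -/
def cc_C36 : C36 := Multiplicative.ofAdd ((2 ^ 1 * 3 ^ 2 : ℕ) : ZMod 36)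

/-- `C₃₆` (`b = 2`: two descent levels): no single-class `SumTwo` quadruple without a conjugate pair. -/
theorem not_isSingleClass_C36_cyclic (T : Fin 4 → Finset C36) (hT : IsCMType cc_C36 (T 0)) (hs : SumTwo T)
    (hnc : ∀ i j : Fin 4, T j ≠ cc_C36 • T i) : ¬ IsSingleClass T :=
  not_isSingleClass_cyclic (a := 1) (b := 2) Nat.prime_three (by norm_num) (by norm_num) T hT hs hnc

/-- The cyclic group of order `40`. -/
abbrev C40 := Multiplicative (ZMod 40)

/-- Its involution `20 = 2^2 · 5^1`. -/
def cc_C40 : C40 := Multiplicative.ofAdd ((2 ^ 2 * 5 ^ 1 : ℕ) : ZMod 40)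

/-- `C₄₀`: no single-class `SumTwo` quadruple without a conjugate pair. -/
theorem not_isSingleClass_C40_cyclic (T : Fin 4 → Finset C40) (hT : IsCMType cc_C40 (T 0)) (hs : SumTwo T)
    (hnc : ∀ i j : Fin 4, T j ≠ cc_C40 • T i) : ¬ IsSingleClass T :=
  not_isSingleClass_cyclic (a := 2) (b := 1) Nat.prime_five (by norm_num) (by norm_num) T hT hs hnc

/-- The cyclic group of order `48`. -/
abbrev C48 := Multiplicative (ZMod 48)

/-- Its involution `24 = 2^3 · 3^1`. -/
def cc_C48 : C48 := Multiplicative.ofAdd ((2 ^ 3 * 3 ^ 1 : ℕ) : ZMod 48)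

/-- `C₄₈`: no single-class `SumTwo` quadruple without a conjugate pair (a cyclic Galois CM field of degree `48`). -/
theorem not_isSingleClass_C48_cyclic (T : Fin 4 → Finset C48) (hT : IsCMType cc_C48 (T 0)) (hs : SumTwo T)
    (hnc : ∀ i j : Fin 4, T j ≠ cc_C48 • T i) : ¬ IsSingleClass T :=
  not_isSingleClass_cyclic (a := 3) (b := 1) Nat.prime_three (by norm_num) (by norm_num) T hT hs hnc

end HodgeRepro.CyclicQuad
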